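import Summits.QuantumFields.BalabanUV.Beta.GAN24.SecondResponseZeroMode
import Summits.QuantumFields.BalabanUV.Beta.GAN24.ExchangeBondLegs

/-!
# `BalabanUV.Beta.GAN24.ChannelBondLegs` — row G-an2-4 ∕ (CONV-C), W-slot, road «W3» (SKELETON-W3 §7.2 ∕ §8.3 (F2)), «W3-S3C*» PART 6
# THE FOUR (S3c)-CONSUMING CHANNELS IN THE UNSANDWICHED DOUBLE-LEG CURRENCY (the binder shape of the ROW W3-F2a assembly, leaf-20 l.≈10080):
# `HasSum (u′ ↦ Σ'_{(v,p)} V u′ v p (inl a) (inl b)) 0` for `V u′ ∈ {dM (K2OfK … (κ′,u′)) … (κ,u), dM (K2OfK … (κ,u)) … (κ′,u′),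
# (dM_{(κ,u)} ∘ K) ∘ dM_{(κ′,u′)} (= module (C1) `hasSum_bond_legs_exchange`, recalled), (dM_{(κ′,u′)} ∘ K) ∘ dM_{(κ,u)}}`

NOT IN PRINT; OUR BOOKKEEPING (idle-seat kernel lemma, unit `b2b-balaban-gan24-formalise-leaf-06`, gen 9; requested by the ROW W3-F2a assembler
leaf-20-g18 — its `WSlotSourceZeroMode` closes the row from these four scalar facts plus leaf-14's mixed channel).  HONEST FRAMING (cell contract,
verbatim): «discharging `BetaPertH` makes Bałaban's UV stability UNCONDITIONAL — a real constructive-QFT result; it is NOT the continuum limit and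
NOT the Clay problem.»  HONEST DEPENDENCY (verbatim): «continuum YM on T⁴ ⇐ BetaPertH ∧ nine spine estimates (0/9 proved); BetaPertH ⇐ (D1) ∧ (D4)
∧ CAP+tail; G-an2-4 gates asym, D1 and NE2/3/4.»

WHAT ([folklore]; generic `d`, `N ≥ 1`, generic `K` ∕ `S` ∕ `M` under the hypothesis bundle of modules (B)∕(C); 0 `def`, 0 cite, 0 sorry):
* **`hasSum_tsum_prod_resp_bond`** — `V u′ := dM (K2OfK K N S M κ′ u′) N S M κ u`: value per bond = `Σ_ρ (Σ'_w colM (K2OfK … κ′ u′) N κ u ρ w)·(Σ' M ρ 0)_{ab}`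
  (module (B1) `hasSum_legs_dM_of_biLoc` at an2's `vertexFamily_K2OfK`), bond series of the masses = 0 (module (B2) `hasSum_colM_K2OfK_bond`).
* **`hasSum_tsum_prod_resp_swap_bond`** — `V u′ := dM (K2OfK K N S M κ u) N S M κ′ u′`: the same with module (B2) `hasSum_colM_K2OfK_pos`.
* **`hasSum_tsum_prod_exchange_swap_bond`** — `V u′ := (dM_{(κ′,u′)} ∘ K) ∘ dM_{(κ,u)}`: by block covariance (an2's `dM_translate`, `comp_shiftK`,
  gen 8 `tsum_prod_shiftK`) the pair sum is the one of `(dM_{(κ′,0)} ∘ K) ∘ dM_{(κ,u−u′)}`, so module (C1) at the first bond `(κ′, 0)` re-indexed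
  along `u′ ↦ u − u′`.
Asserts NO shape or value of Bałaban's tables, pins no colour constant; discharges NOTHING of ROW W3-F2a ∕ F2b, «T2Shape» ∕ «T2SupRate», (hW, hWall);
0 wall binders; NOT «W-slot closed», NEVER «G-an2-4 closed»; NOT BetaPertH, NOT continuum, NOT Clay.
-/

noncomputable section

open Finset
open scoped BigOperators
open Literature.MathematicalPhysics.QuantumFieldTheory
open Literature.MathematicalPhysics.QuantumFieldTheory.Balaban1983to89
open Literature.MathematicalPhysics.QuantumFieldTheory.Balaban1983to89.Beta
open Literature.Probability.LatticeModels (Torus.proj)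
open ExpKernelCalculus (Site MKer BiLoc Decays VertexFamily comp shiftK comp_shiftK)
open OneStepResolventKernel (Fib LocStencil decays_mono biLoc_mono)
open SecondOrderResponse (colM dM K2OfK cK2 vertexFamily_K2OfK dM_translate)
open BalabanStepJets (locStencil_mono)
open Summit.QuantumFields.BalabanUV.Beta.GAN24.KernelLegCharges (tsum_prod_shiftK)
open Summit.QuantumFields.BalabanUV.Beta.GAN24.SecondResponseReadout (hasSum_legs_dM_of_biLoc)
open Summit.QuantumFields.BalabanUV.Beta.GAN24.SecondResponseZeroMode (hasSum_colM_K2OfK_bond hasSum_colM_K2OfK_pos)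
open Summit.QuantumFields.BalabanUV.Beta.GAN24.ExchangeBondLegs (hasSum_bond_legs_exchange)

namespace Summit.QuantumFields.BalabanUV.Beta.GAN24.ChannelBondLegs

variable {d : ℕ} {N : ℕ} [NeZero N]
variable {K : MKer (d + 1) (Fib d)} {C m : ℝ} {ρL ρR : Fin (d + 1) → Fib d → ℝ}
  {S : Fin (d + 1) → Site (d + 1) → MKer (d + 1) (Fib d)} {Cs : ℝ}
  {M : Fin (d + 1) → Site (d + 1) → MKer (d + 1) (Fib d)} {CM : ℝ}

/-! ## §1 The second-response pieces on two constant field legs, summed over the free bond -/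

/-- [folklore] **SECOND-RESPONSE PIECE, `K2OfK` RUNNING WITH THE SUMMED BOND, ON TWO CONSTANT FIELD LEGS**:
`HasSum (u′ ↦ Σ'_{(v,p)} dM (K2OfK K N S M κ′ u′) N S M κ u v p (inl a) (inl b)) 0`. -/
theorem hasSum_tsum_prod_resp_bond (hK : Decays K C m) (hm : 0 < m)
    (hrow : ∀ α f y, HasSum (fun x' : Site (d + 1) => K ((N : ℤ) • x') y (Sum.inr α) f) (ρL α f))
    (hcol : ∀ β g w, HasSum (fun z' : Site (d + 1) => K w ((N : ℤ) • z') g (Sum.inr β)) (ρR β g))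
    (hL0 : ∀ α μ, ρL α (Sum.inr μ) = 0) (hR0 : ∀ β μ, ρR β (Sum.inr μ) = 0)
    (hoffL : ∀ (x z : Site (d + 1)) (ρ : Fin (d + 1)) (b : Fib d), Torus.proj N x ≠ 0 → K x z (Sum.inr ρ) b = 0)
    (hS : LocStencil S Cs m)
    (hS0 : ∀ (κ : Fin (d + 1)) (t : Site (d + 1)) (a b : Fin (d + 1)),
      HasSum (fun vp : Site (d + 1) × Site (d + 1) => S κ t vp.1 vp.2 (Sum.inl a) (Sum.inl b)) 0)
    (hS1 : ∀ (κ : Fin (d + 1)) (q : Site (d + 1)) (a b : Fin (d + 1)),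
      HasSum (fun tp : Site (d + 1) × Site (d + 1) => S κ tp.1 tp.2 q (Sum.inl a) (Sum.inl b)) 0)
    (hSt : ∀ (κ : Fin (d + 1)) (u s : Site (d + 1)), S κ (u + (N : ℤ) • s) = shiftK (-((N : ℤ) • s)) (S κ u))
    (hM : VertexFamily M N CM m) (hMt : ∀ (ρ : Fin (d + 1)) (w t : Site (d + 1)), M ρ (w + t) = shiftK (-((N : ℤ) • t)) (M ρ w))
    (κ : Fin (d + 1)) (u : Site (d + 1)) (κ' a b : Fin (d + 1)) :
    HasSum (fun u' : Site (d + 1) => ∑' vp : Site (d + 1) × Site (d + 1),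
      dM (K2OfK K N S M κ' u') N S M κ u vp.1 vp.2 (Sum.inl a) (Sum.inl b)) 0 := by
  have hC : 0 ≤ C := hK.nonneg (Sum.inl 0)
  have hCs : 0 ≤ Cs := (hS 0 0).nonneg (Sum.inl 0)
  have hCM : 0 ≤ CM := (hM 0 0).nonneg (Sum.inl 0)
  have hm8 : 0 < m / 8 := by positivity
  have hK2v := vertexFamily_K2OfK hK hC hm hS hM
  have hS8 : LocStencil S Cs (m / 8) := locStencil_mono hS hCs (by linarith)
  have hM8 : VertexFamily M N CM (m / 8) := fun ρ w => biLoc_mono (hM ρ w) hCM (by linarith)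
  have hval : ∀ u' : Site (d + 1), (∑' vp : Site (d + 1) × Site (d + 1),
      dM (K2OfK K N S M κ' u') N S M κ u vp.1 vp.2 (Sum.inl a) (Sum.inl b))
        = ∑ ρ : Fin (d + 1), (∑' w : Site (d + 1), colM (K2OfK K N S M κ' u') N κ u ρ w) *
          ∑' vp : Site (d + 1) × Site (d + 1), M ρ 0 vp.1 vp.2 (Sum.inl a) (Sum.inl b) :=
    fun u' => (hasSum_legs_dM_of_biLoc hm8 hS8 hS0 hM8 hMt (hK2v κ' u') κ u a b).tsum_eq
  have h := hasSum_sum (s := (Finset.univ : Finset (Fin (d + 1)))) fun ρ _ =>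
    (hasSum_colM_K2OfK_bond hK hm hrow hcol hL0 hR0 hoffL hS hS1 hSt hM κ u κ' ρ).mul_right
      (∑' vp : Site (d + 1) × Site (d + 1), M ρ 0 vp.1 vp.2 (Sum.inl a) (Sum.inl b))
  simp only [zero_mul, Finset.sum_const_zero] at h
  exact h.congr_fun fun u' => (hval u').symm ▸ rfl

/-- [folklore] **SECOND-RESPONSE PIECE, `K2OfK` AT THE FIXED BOND, ON TWO CONSTANT FIELD LEGS**:
`HasSum (u′ ↦ Σ'_{(v,p)} dM (K2OfK K N S M κ u) N S M κ′ u′ v p (inl a) (inl b)) 0`. -/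
theorem hasSum_tsum_prod_resp_swap_bond (hK : Decays K C m) (hm : 0 < m)
    (hrow : ∀ α f y, HasSum (fun x' : Site (d + 1) => K ((N : ℤ) • x') y (Sum.inr α) f) (ρL α f))
    (hcol : ∀ β g w, HasSum (fun z' : Site (d + 1) => K w ((N : ℤ) • z') g (Sum.inr β)) (ρR β g))
    (hL0 : ∀ α μ, ρL α (Sum.inr μ) = 0) (hR0 : ∀ β μ, ρR β (Sum.inr μ) = 0) (hS : LocStencil S Cs m)
    (hS0 : ∀ (κ : Fin (d + 1)) (t : Site (d + 1)) (a b : Fin (d + 1)),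
      HasSum (fun vp : Site (d + 1) × Site (d + 1) => S κ t vp.1 vp.2 (Sum.inl a) (Sum.inl b)) 0)
    (hM : VertexFamily M N CM m) (hMt : ∀ (ρ : Fin (d + 1)) (w t : Site (d + 1)), M ρ (w + t) = shiftK (-((N : ℤ) • t)) (M ρ w))
    (κ : Fin (d + 1)) (u : Site (d + 1)) (κ' a b : Fin (d + 1)) :
    HasSum (fun u' : Site (d + 1) => ∑' vp : Site (d + 1) × Site (d + 1),
      dM (K2OfK K N S M κ u) N S M κ' u' vp.1 vp.2 (Sum.inl a) (Sum.inl b)) 0 := by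
  have hC : 0 ≤ C := hK.nonneg (Sum.inl 0)
  have hCs : 0 ≤ Cs := (hS 0 0).nonneg (Sum.inl 0)
  have hCM : 0 ≤ CM := (hM 0 0).nonneg (Sum.inl 0)
  have hm8 : 0 < m / 8 := by positivity
  have hK2 : BiLoc (K2OfK K N S M κ u) ((N : ℤ) • u) ((N : ℤ) • u) (cK2 d C Cs CM m) (m / 8) := vertexFamily_K2OfK hK hC hm hS hM κ u
  have hS8 : LocStencil S Cs (m / 8) := locStencil_mono hS hCs (by linarith)
  have hM8 : VertexFamily M N CM (m / 8) := fun ρ w => biLoc_mono (hM ρ w) hCM (by linarith)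
  have hval : ∀ u' : Site (d + 1), (∑' vp : Site (d + 1) × Site (d + 1),
      dM (K2OfK K N S M κ u) N S M κ' u' vp.1 vp.2 (Sum.inl a) (Sum.inl b))
        = ∑ ρ : Fin (d + 1), (∑' w : Site (d + 1), colM (K2OfK K N S M κ u) N κ' u' ρ w) *
          ∑' vp : Site (d + 1) × Site (d + 1), M ρ 0 vp.1 vp.2 (Sum.inl a) (Sum.inl b) :=
    fun u' => (hasSum_legs_dM_of_biLoc hm8 hS8 hS0 hM8 hMt hK2 κ' u' a b).tsum_eq
  have h := hasSum_sum (s := (Finset.univ : Finset (Fin (d + 1)))) fun ρ _ =>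
    (hasSum_colM_K2OfK_pos hK hm hrow hcol hL0 hR0 hS hS0 hM hMt κ u κ' ρ).mul_right
      (∑' vp : Site (d + 1) × Site (d + 1), M ρ 0 vp.1 vp.2 (Sum.inl a) (Sum.inl b))
  simp only [zero_mul, Finset.sum_const_zero] at h
  exact h.congr_fun fun u' => (hval u').symm ▸ rfl

/-! ## §2 The exchange middle with the summed bond in the FIRST factor -/

omit [NeZero N] in
/-- [folklore] A two-fold composition of shifted kernels around a shift-invariant `K` is the shifted composition (`comp_shiftK` twice). -/
theorem comp_comp_shiftK {P Q : MKer (d + 1) (Fib d)} {s : Site (d + 1)} (hK : shiftK s K = K) :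
    comp (comp (shiftK s P) K) (shiftK s Q) = shiftK s (comp (comp P K) Q) := by
  conv_rhs => rw [← comp_shiftK, ← comp_shiftK, hK]

/-- [folklore] **EXCHANGE MIDDLE WITH THE SUMMED BOND IN THE FIRST FACTOR, ON TWO CONSTANT FIELD LEGS**: for a block-covariant `K` (plus the
hypotheses of module (C1)), `HasSum (u′ ↦ Σ'_{(v,w)} ((dM K N S M κ′ u′ ∘ K) ∘ dM K N S M κ u)(v, w)_{(inl a, inl b)}) 0` — by covariance the
pair sum is that of `(dM_{(κ′,0)} ∘ K) ∘ dM_{(κ,u−u′)}`, i.e. module (C1) `hasSum_bond_legs_exchange` at the first bond `(κ′, 0)` re-indexed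
along `u′ ↦ u − u′`. -/
theorem hasSum_tsum_prod_exchange_swap_bond (hK : Decays K C m) (hm : 0 < m) (hKs : ∀ t : Site (d + 1), shiftK (-((N : ℤ) • t)) K = K)
    (hrow : ∀ α f y, HasSum (fun x' : Site (d + 1) => K ((N : ℤ) • x') y (Sum.inr α) f) (ρL α f))
    (hcol : ∀ β g w, HasSum (fun z' : Site (d + 1) => K w ((N : ℤ) • z') g (Sum.inr β)) (ρR β g))
    (hL0 : ∀ α μ, ρL α (Sum.inr μ) = 0) (hR0 : ∀ β μ, ρR β (Sum.inr μ) = 0)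
    (hoffR : ∀ (x z : Site (d + 1)) (a : Fib d) (ρ : Fin (d + 1)), Torus.proj N z ≠ 0 → K x z a (Sum.inr ρ) = 0)
    (hS : LocStencil S Cs m)
    (hS0 : ∀ (κ : Fin (d + 1)) (t : Site (d + 1)) (a b : Fin (d + 1)),
      HasSum (fun vp : Site (d + 1) × Site (d + 1) => S κ t vp.1 vp.2 (Sum.inl a) (Sum.inl b)) 0)
    (hS2 : ∀ (κ : Fin (d + 1)) (p : Site (d + 1)) (a b : Fin (d + 1)),
      HasSum (fun tq : Site (d + 1) × Site (d + 1) => S κ tq.1 p tq.2 (Sum.inl a) (Sum.inl b)) 0)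
    (hSt : ∀ (κ : Fin (d + 1)) (u s : Site (d + 1)), S κ (u + (N : ℤ) • s) = shiftK (-((N : ℤ) • s)) (S κ u))
    (hM : VertexFamily M N CM m) (hMt : ∀ (ρ : Fin (d + 1)) (w t : Site (d + 1)), M ρ (w + t) = shiftK (-((N : ℤ) • t)) (M ρ w))
    (κ : Fin (d + 1)) (u : Site (d + 1)) (κ' a b : Fin (d + 1)) :
    HasSum (fun u' : Site (d + 1) => ∑' vw : Site (d + 1) × Site (d + 1),
      comp (comp (dM K N S M κ' u') K) (dM K N S M κ u) vw.1 vw.2 (Sum.inl a) (Sum.inl b)) 0 := by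
  have h0 := hasSum_bond_legs_exchange hK hm hrow hcol hL0 hR0 hoffR hS hS0 hS2 hSt hM hMt κ' 0 κ a b
  have hT : ∀ u' : Site (d + 1), (∑' vw : Site (d + 1) × Site (d + 1),
      comp (comp (dM K N S M κ' u') K) (dM K N S M κ u) vw.1 vw.2 (Sum.inl a) (Sum.inl b))
        = ∑' vw : Site (d + 1) × Site (d + 1),
          comp (comp (dM K N S M κ' 0) K) (dM K N S M κ (u - u')) vw.1 vw.2 (Sum.inl a) (Sum.inl b) := by
    intro u'
    have e1 : dM K N S M κ' u' = shiftK (-((N : ℤ) • u')) (dM K N S M κ' 0) := by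
      have h := dM_translate hKs hSt hMt κ' 0 u'
      rwa [zero_add] at h
    have e2 : dM K N S M κ u = shiftK (-((N : ℤ) • u')) (dM K N S M κ (u - u')) := by
      have h := dM_translate hKs hSt hMt κ (u - u') u'
      rwa [sub_add_cancel] at h
    rw [e1, e2, comp_comp_shiftK (hKs u'), tsum_prod_shiftK]
  simp_rw [hT]
  have h := (Equiv.subLeft u).hasSum_iff (f := fun y : Site (d + 1) => ∑' vw : Site (d + 1) × Site (d + 1),
    comp (comp (dM K N S M κ' 0) K) (dM K N S M κ y) vw.1 vw.2 (Sum.inl a) (Sum.inl b)) |>.2 h0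
  simpa only [Function.comp_def, Equiv.subLeft_apply] using h

end Summit.QuantumFields.BalabanUV.Beta.GAN24.ChannelBondLegs

end
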